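import Literature.AlgebraicGeometry.ModuliOfAbelianVarieties.SiegelFineModuliSchemeClassifyDescIndependent
import Literature.AlgebraicGeometry.AbelianSchemes.SymplecticRefinementFiniteEtaleCover
import Literature.AlgebraicGeometry.AbelianSchemes.AbelianSchemeOverHomNoetherianAnyBase
import HarnessLib

/-!
# F-10 (b) existence: every level-`N₀` triple has a descended classifying map through every twist-killed quotient of
# `A_{g,δ,N₀d}` ([MFK94] Ch. 7 §3 pp. 139–142, App. 7A; [Lan 2013] Rem. 1.4.1.9)

Topic `AlgebraicGeometry/ModuliOfAbelianVarieties`; namespaces `Literature.AlgebraicGeometry.AbelianSchemes.PolarizedAbelianSchemeWithLevel`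
(§1) and `Literature.AlgebraicGeometry.ModuliOfAbelianVarieties.SiegelFineModuliScheme` (§2).  THEOREMS ONLY (no
definition, no named fact, no instance, no notation, no `sorry`; net Literature debt 0).  Cell hodgecm-mathlib (D-0151),
F-DAG leaf F-10 (b) «`classify` for the quotient `M/Γ`» — the CAPSTONE of the (b) chain: ★ (b4) THE COVER
(`LevelStructure.exists_finite_etale_surjective_symplecticRefinement`, B-p02: over a finite étale surjective `W → T` a
level-`N₀` structure refines to a symplectic-liftable level-`N₀ d` structure) is read as a REFINEMENT DATUM
`(c : T′ → T, P′, G, Ĝ)` with `(P′.changeLevel N₀).IsBaseChangeVia Y c G Ĝ` (§1), and ★ (b2)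
`SiegelFineModuliScheme.existsUnique_desc_classifyingMap_left_comp` (fpqc descent of `classifyingMap P′ ≫ p` along `c`)
yields the descended map `f : T → Q` for every `p : A_{g,δ,N₀ d} → Q` killed by the twist operators of `K_δ(N₀)` (§2); by ★
`desc_classifyingMap_left_comp_independent` it does not depend on the datum.  [MumfordFogartyKirwan1994] Ch. 7 §3
(pp. 139–142): `A_{g,d,n}/Γ` represents the coarser level functor — this is the existence half of that natural
transformation, with the quotient `p` kept abstract (the finite quotient `M → M/ρ(K_δ(N₀))` and the relation
`Y ≅ f^* X_{M/Γ}` are downstream).  HC_CM is proved only modulo the 7 printed citations until rung 0 closes; this file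
discharges none of them (count-neutral capital).

* §1 **`PolarizedAbelianSchemeWithLevel.exists_finite_etale_refinement`** — `∃ T′ c P′ G Ĝ, IsFinite c ∧ Etale c ∧ Surjective c ∧
  (P′.changeLevel N₀ d).IsBaseChangeVia Y c G Ĝ` (`T′ := W`, `P′ := ((Y ×_T B) ×_B W` with level `Φ|_W`)`; ★
  `baseChange_isBaseChangeVia`, `IsBaseChangeVia.trans`; positive integers are invertible in the residue fields of a
  `ℚ`-scheme).
* §2 **`SiegelFineModuliScheme.exists_desc_classifyingMap`** — `∃ T′ c P′ G Ĝ f, … ∧ c ≫ f = classifyingMap P′ ≫ p`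
  (§1 + ★ `existsUnique_desc_classifyingMap_left_comp`; the refined abelian scheme is commutative by ★
  `isCommMonObj_of_isLocallyNoetherian_base`, `T′` locally Noetherian by Mathlib `LocallyOfFiniteType.isLocallyNoetherian`).

Mathlib searched (pin): `LocallyOfFiniteType.isLocallyNoetherian`, instances `IsFinite`/`Etale` ⇒ `Flat`, `QuasiCompact`,
`LocallyOfFiniteType` and their stability under composition (all used).

## References
* D. Mumford, J. Fogarty, F. Kirwan, *Geometric Invariant Theory*, 3rd ed. (1994), Ch. 7 §3 (pp. 139–140; pp. 140–142),
  App. 7A (p. 235). [MumfordFogartyKirwan1994]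
* K.-W. Lan, *Arithmetic compactifications of PEL-type Shimura varieties* (2013), §1.4.1 Remark 1.4.1.9 (p. 90).
  [Lan2013PELCompactifications]
-/

noncomputable section

open CategoryTheory CategoryTheory.Limits AlgebraicGeometry
open scoped MonObj

namespace Literature.AlgebraicGeometry.AbelianSchemes.PolarizedAbelianSchemeWithLevel

open Literature.AlgebraicGeometry.Motives (SchemeOver)
open AbelianSchemeOver

variable {g N₀ d : ℕ} {δ : Fin g → ℕ} [NeZero N₀]

/-- Over a `ℚ`-scheme no positive integer vanishes in a residue field. [folklore] -/
private theorem natCast_residueField_ne_zero (T : SchemeOver ℚ) (M : ℕ) (hM : M ≠ 0) (t : T.left) :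
    (M : T.left.residueField t) ≠ 0 := by
  let φ : ℚ →+* T.left.residueField t := (Spec.preimage (T.left.fromSpecResidueField t ≫ T.hom)).hom
  rw [← map_natCast φ M]
  exact (map_ne_zero φ).mpr (Nat.cast_ne_zero.mpr hM)

/-! ### §1 The refinement datum of a level-`N₀` triple over a locally Noetherian `ℚ`-scheme -/

/-- **EVERY LEVEL-`N₀` TRIPLE OVER A LOCALLY NOETHERIAN `ℚ`-SCHEME REFINES TO LEVEL `N₀ d` OVER A FINITE ÉTALE SURJECTIVE
COVER** — the refinement datum `(c : T′ → T, P′, G, Ĝ)` consumed by ★ `SiegelFineModuliScheme.existsUnique_desc_classifyingMap_left_comp`,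
read off ★ `LevelStructure.exists_finite_etale_surjective_symplecticRefinement` (the (b4) cover: `W ↪ B → T` finite étale
surjective, a symplectic-liftable level-`N₀ d` structure `Φ|_W` on `A ×_T W` with `(Φ|_W).changeLevel N₀ = ψ ×_T W`):
`T′ := W`, `P′ := (Y ×_T B) ×_B W` with its level structure replaced by `Φ|_W` — so `P′.changeLevel N₀ = (Y ×_T B) ×_B W`
IS a pull-back of `Y` (★ `baseChange_isBaseChangeVia`, `IsBaseChangeVia.trans`).  [MumfordFogartyKirwan1994] Ch. 7 §3 /
App. 7A: `𝒜_{g,δ,nm} → 𝒜_{g,δ,n}` is finite étale surjective; [Lan2013PELCompactifications] Rem. 1.4.1.9.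
[cite: MumfordFogartyKirwan1994, Ch. 7 §3 (p. 139) and App. 7A (p. 235)] [cite: Lan2013PELCompactifications, §1.4.1 Remark 1.4.1.9 (p. 90)] -/
theorem exists_finite_etale_refinement (hd : d ≠ 0) (T : SchemeOver ℚ) [IsLocallyNoetherian T.left]
    (Y : PolarizedAbelianSchemeWithLevel g N₀ δ T.left) :
    ∃ (T' : SchemeOver ℚ) (c : T' ⟶ T) (P' : PolarizedAbelianSchemeWithLevel g (N₀ * d) δ T'.left)
      (G : P'.A.X.left ⟶ Y.A.X.left) (Ĝ : P'.D.hat.X.left ⟶ Y.D.hat.X.left),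
      IsFinite c.left ∧ Etale c.left ∧ Surjective c.left ∧
      (P'.changeLevel N₀ d rfl (Nat.mul_ne_zero (NeZero.ne N₀) hd)).IsBaseChangeVia Y c.left G Ĝ := by
  obtain ⟨B, b, Φ, W, hfin, het, -, hfinW, hetW, hsurj, hchange, hsympl⟩ :=
    LevelStructure.exists_finite_etale_surjective_symplecticRefinement Y.A Y.pol Y.level δ Y.relDim
      (fun M hM t => natCast_residueField_ne_zero T M hM t) Y.symplectic (NeZero.ne N₀) (K := d) hd
  haveI := hfin
  haveI := het
  haveI := hfinW
  haveI := hetW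
  -- the refined triple over `W`: `(Y ×_T B) ×_B W` with its level structure replaced by `Φ|_W`
  let X : PolarizedAbelianSchemeWithLevel g N₀ δ (W : Scheme) := (Y.baseChange b).baseChange W.ι
  let P' : PolarizedAbelianSchemeWithLevel g (N₀ * d) δ (W : Scheme) :=
    { X with level := Φ.baseChange W.ι, symplectic := hsympl }
  let T' : SchemeOver ℚ := Over.mk ((W.ι ≫ b) ≫ T.hom)
  let c : T' ⟶ T := Over.homMk (W.ι ≫ b) rfl
  -- `X` is a pull-back of `Y` along `W ↪ B → T`; only the level clause sees the level structure
  obtain ⟨hl, hh, hP, hlam⟩ := ((Y.baseChange b).baseChange_isBaseChangeVia W.ι).trans (Y.baseChange_isBaseChangeVia b)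
  have hl' : ((Φ.baseChange W.ι).changeLevel N₀ d rfl (Nat.mul_ne_zero (NeZero.ne N₀) hd)).IsBaseChangeVia Y.level
      (W.ι ≫ b) (pullback.fst (Y.baseChange b).A.X.hom W.ι ≫ pullback.fst Y.A.X.hom b) := by
    rw [hchange]; exact hl
  exact ⟨T', c, P', _, _, inferInstanceAs (IsFinite (W.ι ≫ b)), inferInstanceAs (Etale (W.ι ≫ b)), hsurj,
    ⟨hl', hh, hP, hlam⟩⟩

end Literature.AlgebraicGeometry.AbelianSchemes.PolarizedAbelianSchemeWithLevel

namespace Literature.AlgebraicGeometry.ModuliOfAbelianVarieties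

open Literature.AlgebraicGeometry.Motives (SchemeOver)
open Literature.AlgebraicGeometry.AbelianSchemes (PolarizedAbelianSchemeWithLevel)
open Literature.AlgebraicGeometry.AbelianSchemes.AbelianSchemeOver
open Literature.NumberTheory.Adeles NumberField IsDedekindDomain

namespace SiegelFineModuliScheme

variable {g N₀ d : ℕ} {δ : Fin g → ℕ} [NeZero N₀] [NeZero (N₀ * d)]
  (𝓜 : SiegelFineModuliScheme g (N₀ * d) δ) [IsCommMonObj 𝓜.univ.A.X]

/-! ### §2 Existence of the descended classifying map -/

/-- **F-10 (b), EXISTENCE: every level-`N₀` triple over a locally Noetherian `ℚ`-scheme `T` has a descended classifying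
map `f : T → Q` through every morphism `p : A_{g,δ,N₀ d} → Q` killed by the twist operators of `K_δ(N₀)`** — with a
finite étale surjective refining cover `c : T′ → T` and a refinement `P′` (§1) such that `c ≫ f = classifyingMap P′ ≫ p`;
by ★ `desc_classifyingMap_left_comp_independent` this `f` does not depend on `(T′, c, P′)`.  ([MumfordFogartyKirwan1994]
Ch. 7 §3 pp. 139–142: `A_{g,d,n}/Γ` represents the coarser level problem — the existence half of the natural
transformation; [Lan2013PELCompactifications] Rem. 1.4.1.9.)  Assembled from §1 and ★
`existsUnique_desc_classifyingMap_left_comp` (fpqc descent of morphisms along the finite étale cover; commutativity of the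
refined abelian scheme by ★ `isCommMonObj_of_isLocallyNoetherian_base`).
[cite: MumfordFogartyKirwan1994, Ch. 7 §3 (pp. 139–140)] [cite: Lan2013PELCompactifications, §1.4.1 Remark 1.4.1.9 (p. 90)] -/
theorem exists_desc_classifyingMap (hδ : IsPolarizationType δ) (hg : 0 < g) (hd : d ≠ 0)
    (T : SchemeOver ℚ) [IsLocallyNoetherian T.left] (Y : PolarizedAbelianSchemeWithLevel g N₀ δ T.left)
    {Q : Scheme} (p : 𝓜.M.left ⟶ Q)
    (hp : ∀ r : gspFinAdelic δ, r ∈ principalLevelSubgroup δ N₀ → ∀ GN : GL (Fin g ⊕ Fin g) (ZMod (N₀ * d)),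
      (∀ (i j : Fin g ⊕ Fin g)
        (h : ((r : GL (Fin g ⊕ Fin g) finAdeleQ) : Matrix (Fin g ⊕ Fin g) (Fin g ⊕ Fin g) finAdeleQ) i j ∈
          FiniteAdeleRing.integralAdeles (𝓞 ℚ) ℚ),
        (GN : Matrix (Fin g ⊕ Fin g) (Fin g ⊕ Fin g) (ZMod (N₀ * d))) i j = integralAdeleResidue (N₀ * d) ⟨_, h⟩) →
      ∀ hs : (𝓜.univ.level.twist GN).IsSymplecticLiftable 𝓜.univ.pol δ,
        (haveI := 𝓜.isLocallyNoetherian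
         (𝓜.classifyingMap 𝓜.M ({ 𝓜.univ with level := 𝓜.univ.level.twist GN, symplectic := hs } :
           PolarizedAbelianSchemeWithLevel g (N₀ * d) δ 𝓜.M.left)).left) ≫ p = p) :
    ∃ (T' : SchemeOver ℚ) (c : T' ⟶ T) (_ : IsLocallyNoetherian T'.left)
      (P' : PolarizedAbelianSchemeWithLevel g (N₀ * d) δ T'.left)
      (G : P'.A.X.left ⟶ Y.A.X.left) (Ĝ : P'.D.hat.X.left ⟶ Y.D.hat.X.left) (f : T.left ⟶ Q),
      IsFinite c.left ∧ Etale c.left ∧ Surjective c.left ∧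
      (P'.changeLevel N₀ d rfl (Nat.mul_ne_zero (NeZero.ne N₀) hd)).IsBaseChangeVia Y c.left G Ĝ ∧
      c.left ≫ f = (𝓜.classifyingMap T' P').left ≫ p := by
  obtain ⟨T', c, P', G, Ĝ, hfin, het, hsurj, hY⟩ :=
    PolarizedAbelianSchemeWithLevel.exists_finite_etale_refinement (δ := δ) hd T Y
  haveI := hfin
  haveI := het
  haveI := hsurj
  haveI : IsLocallyNoetherian T'.left := LocallyOfFiniteType.isLocallyNoetherian c.left
  haveI : IsCommMonObj P'.A.X := P'.A.isCommMonObj_of_isLocallyNoetherian_base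
  obtain ⟨f, hf, -⟩ := 𝓜.existsUnique_desc_classifyingMap_left_comp hδ hg rfl c P' hY p hp
  exact ⟨T', c, inferInstance, P', G, Ĝ, f, hfin, het, hsurj, hY, hf⟩

end SiegelFineModuliScheme

end Literature.AlgebraicGeometry.ModuliOfAbelianVarieties

end
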